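import Literature.IUT.LogVolume.ArchimedeanPacketLogVolume
import Literature.IUT.LogVolume.ArchimedeanTensorCopiesInvariance
import HarnessLib

/-!
# [IUTchIV] Theorem 1.10, Step (vii) / Proposition 1.5 (iii): the archimedean packet log-volume on `M_I`
# is intrinsic — independent of the direct sum decomposition, invariant under the induced automorphisms

Mochizuki, *Inter-universal Teichmüller theory IV*, RIMS manuscript (Apr. 2020; = PRIMS **57** (2021)),
Prop. 1.5 (iii), pp. 15–16: "`M_I` admits a unique direct sum decomposition as a direct sum of … copies of
`ℂ` … the direct sum decomposition of `M_I`, the direct sum metric on `M_I`, and the integral structure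
`B_I ⊆ M_I` are preserved by the automorphisms of `M_I` induced by the various primitive automorphisms";
proof of Thm. 1.10, Step (vii), p. 30: "the indeterminacies (Ind1) and (Ind2) are taken into account by
the fact that `B_I ⊆ M_I` is preserved by arbitrary automorphisms of the type discussed in Proposition
1.5, (iii)".

PROVED here (proof-only; classical): any map `F` of `M_I` that PRESERVES a decomposition `Φ` in the sense
of `Prop15iii.PreservesDecomposition` (permutes the copies of `ℂ`, acting on each by a real linear
isometry — e.g. every automorphism induced by primitive automorphisms, `preservesDecomposition_induced`)
acts in coordinates through a Lebesgue-MEASURE-PRESERVING measurable equivalence of `⊕_J ℂ`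
(coordinate permutation: `volume_measurePreserving_piCongrLeft`; isometries of `ℂ`:
`LinearIsometryEquiv.measurePreserving`), so `vol(Φ(F(S))) = vol(Φ(S))` and
**`packetLogVol Φ (F '' S) = packetLogVol Φ S`** (`packetLogVol_image_eq_of_preservesDecomposition`,
`packetLogVol_image_induced`); and two decompositions `Φ`, `Φ'` differ by such a transition
(`prop15iii_unique_holds`), so **`packetLogVol Φ S = packetLogVol Φ' S`** (`packetLogVol_eq`) — the
log-volume of Step (vii) is a well-defined invariant of `M_I`. Nothing here takes a side on [IUTchIII]
Cor. 3.12.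
-/

noncomputable section

namespace Literature.IUT.LogVolume

namespace Prop15iii

open MeasureTheory Set ArchPacket
open scoped ENNReal Pointwise ComplexConjugate

variable {I V : Type} {J J' : Type}

/-! ## Coordinate transitions: permutation of the copies and an isometry on each -/

/-- The coordinate transition "apply the real linear isometry `u_j` on the `j`-th copy of `ℂ`, then re-index
along `e : J ≃ J'`", as a measurable equivalence `⊕_J ℂ ≃ᵐ ⊕_{J'} ℂ`. [claim: Mochizuki2012, status: disputed] -/
def transition (e : J ≃ J') (u : J → (ℂ ≃ₗᵢ[ℝ] ℂ)) : (J → ℂ) ≃ᵐ (J' → ℂ) :=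
  (MeasurableEquiv.piCongrRight fun j => (u j).toHomeomorph.toMeasurableEquiv).trans
    (MeasurableEquiv.piCongrLeft (fun _ : J' => ℂ) e)

/-- The transition on the `e j`-th coordinate: `transition e u y (e j) = u_j (y j)`.
[claim: Mochizuki2012, status: disputed] -/
theorem transition_apply_apply (e : J ≃ J') (u : J → (ℂ ≃ₗᵢ[ℝ] ℂ)) (y : J → ℂ) (j : J) :
    transition e u y (e j) = u j (y j) := by
  unfold transition
  rw [MeasurableEquiv.trans_apply, MeasurableEquiv.piCongrLeft_apply_apply]
  rfl

/-- Coordinate transitions preserve Lebesgue measure. [claim: Mochizuki2012, status: disputed] -/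
theorem measurePreserving_transition [Fintype J] [Fintype J'] (e : J ≃ J') (u : J → (ℂ ≃ₗᵢ[ℝ] ℂ)) :
    MeasurePreserving (transition e u) volume volume := by
  have h1 : MeasurePreserving (MeasurableEquiv.piCongrRight fun j => (u j).toHomeomorph.toMeasurableEquiv)
      (volume : Measure (J → ℂ)) volume :=
    volume_preserving_pi (α' := fun _ : J => ℂ) (β' := fun _ : J => ℂ)
      (f := fun j => (u j).toHomeomorph.toMeasurableEquiv) fun j => (u j).measurePreserving
  exact (volume_measurePreserving_piCongrLeft (fun _ : J' => ℂ) e).comp h1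

/-- Images under a coordinate transition have the same volume. [claim: Mochizuki2012, status: disputed] -/
theorem volume_image_transition [Fintype J] [Fintype J'] (e : J ≃ J') (u : J → (ℂ ≃ₗᵢ[ℝ] ℂ))
    (A : Set (J → ℂ)) : volume (transition e u '' A) = volume A := by
  rw [MeasurableEquiv.image_eq_preimage_symm]
  exact (measurePreserving_transition e u).symm.measure_preimage_equiv _

/-! ## Invariance under decomposition-preserving maps (the induced automorphisms) -/

/-- A decomposition-preserving map acts in coordinates through a transition:
`Φ (F x) = transition e u (Φ x)`. [claim: Mochizuki2012, status: disputed] -/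
theorem exists_transition_of_preservesDecomposition (Φ : Decomposition I V J) {F : MI I V →ₗ[ℝ] MI I V}
    (hF : PreservesDecomposition Φ F) : ∃ (e : J ≃ J) (u : J → (ℂ ≃ₗᵢ[ℝ] ℂ)),
      ∀ x, Φ (F x) = transition e u (Φ x) := by
  obtain ⟨e, u, h⟩ := hF
  refine ⟨e, u, fun x => funext fun j' => ?_⟩
  obtain ⟨j, rfl⟩ := e.surjective j'
  rw [h x j, transition_apply_apply]

/-- **Decomposition-preserving maps preserve volumes in coordinates**: `vol(Φ(F(S))) = vol(Φ(S))`.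
[claim: Mochizuki2012, status: disputed] -/
theorem volume_image_image_eq_of_preservesDecomposition [Fintype J] (Φ : Decomposition I V J)
    {F : MI I V →ₗ[ℝ] MI I V} (hF : PreservesDecomposition Φ F) (S : Set (MI I V)) :
    volume ((Φ : MI I V → (J → ℂ)) '' (F '' S)) = volume ((Φ : MI I V → (J → ℂ)) '' S) := by
  obtain ⟨e, u, h⟩ := exists_transition_of_preservesDecomposition Φ hF
  have himage : (Φ : MI I V → (J → ℂ)) '' (F '' S) = transition e u '' ((Φ : MI I V → (J → ℂ)) '' S) := by
    rw [Set.image_image, Set.image_image]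
    exact Set.image_congr fun x _ => h x
  rw [himage, volume_image_transition]

/-- **The log-volume is invariant under decomposition-preserving maps** ("the indeterminacies (Ind1) and
(Ind2) are taken into account by the fact that `B_I ⊆ M_I` is preserved by arbitrary automorphisms of the
type discussed in Proposition 1.5, (iii)", p. 30). [claim: Mochizuki2012, status: disputed] -/
theorem packetLogVol_image_eq_of_preservesDecomposition [Fintype J] (Φ : Decomposition I V J)
    {F : MI I V →ₗ[ℝ] MI I V} (hF : PreservesDecomposition Φ F) (S : Set (MI I V)) :
    packetLogVol Φ (F '' S) = packetLogVol Φ S := by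
  unfold packetLogVol nlogVol
  rw [volume_image_image_eq_of_preservesDecomposition Φ hF S]

/-- In particular for the automorphisms of `M_I` induced by families of real linear isometries of the
summands `ℂ_v` (⊇ the primitive automorphisms): `packetLogVol Φ (induced σ '' S) = packetLogVol Φ S`.
[claim: Mochizuki2012, status: disputed] -/
theorem packetLogVol_image_induced [Fintype I] [DecidableEq I] [Fintype V] [DecidableEq V] [Fintype J]
    [DecidableEq J] (Φ : Decomposition I V J) (σ : I → V → (ℂ ≃ₗᵢ[ℝ] ℂ)) (S : Set (MI I V)) :
    packetLogVol Φ (induced I V σ '' S) = packetLogVol Φ S :=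
  packetLogVol_image_eq_of_preservesDecomposition Φ (preservesDecomposition_induced Φ σ) S

/-! ## Independence of the decomposition -/

/-- `id` or complex conjugation as a real linear isometry of `ℂ`, matching `cj`.
[claim: Mochizuki2012, status: disputed] -/
def cjLIE (b : Bool) : ℂ ≃ₗᵢ[ℝ] ℂ := if b then Complex.conjLIE else LinearIsometryEquiv.refl ℝ ℂ

/-- `cjLIE b` acts as `cj b`. [claim: Mochizuki2012, status: disputed] -/
@[simp] theorem cjLIE_apply (b : Bool) (z : ℂ) : cjLIE b z = cj b z := by
  cases b
  · rfl
  · simp [cjLIE, cj]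

/-- Two decompositions differ by a transition: `Φ' x = transition e (cjLIE ∘ c) (Φ x)`.
[claim: Mochizuki2012, status: disputed] -/
theorem exists_transition [Fintype J] [DecidableEq J] [Fintype J'] [DecidableEq J']
    (Φ : Decomposition I V J) (Φ' : Decomposition I V J') :
    ∃ (e : J ≃ J') (c : J → Bool), ∀ x, Φ' x = transition e (fun j => cjLIE (c j)) (Φ x) := by
  have hu : Prop15iii_unique I V := prop15iii_unique_holds
  obtain ⟨e, c, h⟩ := hu J J' Φ Φ'
  refine ⟨e, c, fun x => funext fun j' => ?_⟩
  obtain ⟨j, rfl⟩ := e.surjective j'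
  rw [h x j, transition_apply_apply, cjLIE_apply]

/-- **The volume of the image of any `S ⊆ M_I` is the same in every decomposition.**
[claim: Mochizuki2012, status: disputed] -/
theorem volume_image_eq [Fintype J] [DecidableEq J] [Fintype J'] [DecidableEq J']
    (Φ : Decomposition I V J) (Φ' : Decomposition I V J') (S : Set (MI I V)) :
    volume ((Φ' : MI I V → (J' → ℂ)) '' S) = volume ((Φ : MI I V → (J → ℂ)) '' S) := by
  obtain ⟨e, c, h⟩ := exists_transition Φ Φ'
  have himage : (Φ' : MI I V → (J' → ℂ)) '' S =
      transition e (fun j => cjLIE (c j)) '' ((Φ : MI I V → (J → ℂ)) '' S) := by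
    rw [Set.image_image]
    exact Set.image_congr fun x _ => h x
  rw [himage, volume_image_transition]

/-- The integral structures `B ⊆ ⊕_J ℂ`, `B' ⊆ ⊕_{J'} ℂ` of two decompositions of the same `M_I` have the
same volume. [claim: Mochizuki2012, status: disputed] -/
theorem volume_unitBall_eq [Fintype J] [DecidableEq J] [Fintype J'] [DecidableEq J']
    (Φ : Decomposition I V J) (Φ' : Decomposition I V J') :
    volume (unitBall J') = volume (unitBall J) := by
  rw [← image_ball Φ, ← image_ball Φ', ← ball_eq_ball Φ Φ']
  exact volume_image_eq Φ Φ' (ball Φ)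

/-- Two decompositions of the same `M_I` have equinumerous index sets. [claim: Mochizuki2012, status: disputed] -/
theorem card_eq_card [Fintype J] [DecidableEq J] [Fintype J'] [DecidableEq J']
    (Φ : Decomposition I V J) (Φ' : Decomposition I V J') : Fintype.card J = Fintype.card J' := by
  have hu : Prop15iii_unique I V := prop15iii_unique_holds
  obtain ⟨e, -, -⟩ := hu J J' Φ Φ'
  exact Fintype.card_congr e

/-- **The log-volume on `M_I` is intrinsic**: `packetLogVol Φ S = packetLogVol Φ' S` for any two direct sum
decompositions `Φ`, `Φ'` and every `S ⊆ M_I` (Prop. 1.5 (iii) "unique", p. 15, applied to Step (vii),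
p. 30). [claim: Mochizuki2012, status: disputed] -/
theorem packetLogVol_eq [Fintype J] [DecidableEq J] [Fintype J'] [DecidableEq J']
    (Φ : Decomposition I V J) (Φ' : Decomposition I V J') (S : Set (MI I V)) :
    packetLogVol Φ S = packetLogVol Φ' S := by
  unfold packetLogVol nlogVol
  rw [volume_image_eq Φ Φ' S, volume_unitBall_eq Φ Φ', finrank_packet, finrank_packet, card_eq_card Φ Φ']

end Prop15iii

end Literature.IUT.LogVolume

end
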